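import Literature.Analysis.FunctionSpaces.PeriodicLogCost
import Literature.Analysis.FunctionSpaces.TorusMaximalLipschitz
import Literature.Analysis.FunctionSpaces.TorusConvolution
import Literature.Analysis.FluidPDE.TwoPointPairFunctional
import HarnessLib

/-!
# The datum side of the two-point dissipation bound for releases

Analysis/FluidPDE proof-support file (everything proved). Elementary facts about a smooth
datum `h : T^d → ℝ` with `|h| ≤ H`, `‖∇h‖ ≤ L`, paired against a two-point probability density,
as consumed by the logarithmic dissipation bound for releases:

* `abs_sub_le_of_norm_gradient_le` — `|h x - h y| ≤ √d · L · ‖x - y‖` (mean value inequality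
  through the centred lift, `‖reprc z‖ ≤ √d ‖z‖`);
* `sq_sub_le_sinLogCost` — the pointwise splitting at scale `ℓ`:
  `(h x - h y)² ≤ d L² ℓ² + (4H²/log(1 + 4ℓ²/δ²)) Φ_δ(x - y)` with the periodic logarithmic cost
  `Φ_δ` (`FunctionSpaces/PeriodicLogCost`);
* `integral_integral_mul_mul_eq` — the variance identity against a probability density `f`:
  `∫∫ h(x)h(y) f(x)f(y) = ∫ h² f - ½ ∫∫ (h x - h y)² f(x) f(y)`;
* `sq_integral_mul_eq` — `(∫ h f)² = ∫∫ h(x)h(y) f(x)f(y)`;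
* `integral_integral_sinLogCost_kernel_le` — the initial value of the separation functional:
  `∫∫ Φ_δ(x-y) k_ε(x-w) k_ε(y-w) ≤ log(1 + 4π² d ε²/δ²)`.

## References

* G. Crippa, C. De Lellis, J. reine angew. Math. 616 (2008), §2 (splitting at scale).
-/

noncomputable section

open MeasureTheory Set Filter Topology Function Metric Real
open scoped InnerProductSpace Convolution
open Literature.Analysis.FunctionSpaces Literature.Analysis.FunctionSpaces.Torus

namespace Literature.Analysis.FluidPDE

namespace Torus

variable {d : Type*} [Fintype d] [DecidableEq d]

/-! ## The mean value inequality on the torus -/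

omit [DecidableEq d] in
/-- **Mean value inequality on `T^d`**: `|h x - h y| ≤ √d · L · ‖x - y‖` when `‖∇h‖ ≤ L`
(through the periodic lift and the centred representative of `x - y`). [folklore] -/
theorem abs_sub_le_of_norm_gradient_le {h : UnitAddTorus d → ℝ} (hh : IsSmooth h) {L : ℝ}
    (hL : ∀ x, ‖Torus.gradient h x‖ ≤ L) (x y : UnitAddTorus d) :
    |h x - h y| ≤ Real.sqrt (Fintype.card d) * L * ‖x - y‖ := by
  classical
  have hL0 : 0 ≤ L := (norm_nonneg _).trans (hL x)
  -- the lift is differentiable with `‖D(lift h)‖ ≤ L`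
  have hdiff : Differentiable ℝ (lift h) := (hh : ContDiff ℝ _ (lift h)).differentiable (by simp)
  have hbound : ∀ z : EuclideanSpace ℝ d, ‖fderiv ℝ (lift h) z‖ ≤ L := by
    intro z
    have e1 : fderiv ℝ (lift h) z = Torus.fderiv h (proj z) := by
      have := congrFun (lift_torusFderiv h) z
      rw [lift_apply] at this
      exact this.symm
    have e2 : ‖Torus.fderiv h (proj z)‖ = ‖Torus.gradient h (proj z)‖ := by
      rw [Torus.gradient, _root_.gradient, Torus.fderiv, LinearIsometryEquiv.norm_map]
    rw [e1, e2]
    exact hL _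
  -- join `y` to `x` along the centred representative of `x - y`
  obtain ⟨y', hy'⟩ := proj_surjective y
  set v : EuclideanSpace ℝ d := reprc (x - y) with hv
  have hx : proj (y' + v) = x := by
    rw [proj_add, hy', hv, proj_reprc, add_sub_cancel]
  have hmv := Convex.norm_image_sub_le_of_norm_fderiv_le (fun z _ => hdiff.differentiableAt)
    (fun z _ => hbound z) convex_univ (mem_univ y') (mem_univ (y' + v))
  rw [lift_apply, lift_apply, hx, hy', add_sub_cancel_left, Real.norm_eq_abs] at hmv
  calc |h x - h y| ≤ L * ‖v‖ := hmv
    _ ≤ L * (Real.sqrt (Fintype.card d) * ‖x - y‖) :=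
        mul_le_mul_of_nonneg_left (norm_reprc_le_sqrt_card_mul_norm (x - y)) hL0
    _ = Real.sqrt (Fintype.card d) * L * ‖x - y‖ := by ring

/-! ## Splitting at scale `ℓ` -/

omit [DecidableEq d] in
/-- **The pointwise splitting of the increment** at scale `ℓ` against the periodic logarithmic
cost: for `|h| ≤ H`, `‖∇h‖ ≤ L`, `0 ≤ ℓ`, `δ ≠ 0`,
`(h x - h y)² ≤ d L² ℓ² + (4H² / log(1 + 4ℓ²/δ²)) Φ_δ(x - y)`. [folklore] -/
theorem sq_sub_le_sinLogCost {h : UnitAddTorus d → ℝ} (hh : IsSmooth h) {H L ℓ δ : ℝ}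
    (hH : ∀ x, |h x| ≤ H) (hL : ∀ x, ‖Torus.gradient h x‖ ≤ L) (hℓ : 0 < ℓ) (hδ : δ ≠ 0)
    (x y : UnitAddTorus d) :
    (h x - h y) ^ 2 ≤ Fintype.card d * L ^ 2 * ℓ ^ 2 +
      4 * H ^ 2 / Real.log (1 + 4 * ℓ ^ 2 / δ ^ 2) * sinLogCost δ (x - y) := by
  have hΛ : 0 < Real.log (1 + 4 * ℓ ^ 2 / δ ^ 2) := Real.log_pos (by
    have : 0 < 4 * ℓ ^ 2 / δ ^ 2 := by positivity
    linarith)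
  have hcost0 : 0 ≤ sinLogCost δ (x - y) := sinLogCost_nonneg δ _
  have hA : 0 ≤ Fintype.card d * L ^ 2 * ℓ ^ 2 := by positivity
  have hB : 0 ≤ 4 * H ^ 2 / Real.log (1 + 4 * ℓ ^ 2 / δ ^ 2) * sinLogCost δ (x - y) := by positivity
  rcases lt_or_ge ‖x - y‖ ℓ with hlt | hge
  · -- close points: Lipschitz bound
    have h1 := abs_sub_le_of_norm_gradient_le hh hL x y
    have h2 : |h x - h y| ≤ Real.sqrt (Fintype.card d) * L * ℓ :=
      h1.trans (mul_le_mul_of_nonneg_left hlt.le (by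
        have : 0 ≤ L := (norm_nonneg _).trans (hL x); positivity))
    have h3 : (h x - h y) ^ 2 ≤ (Real.sqrt (Fintype.card d) * L * ℓ) ^ 2 := by
      rw [← sq_abs (h x - h y)]
      exact pow_le_pow_left₀ (abs_nonneg _) h2 2
    have h4 : (Real.sqrt (Fintype.card d) * L * ℓ) ^ 2 = Fintype.card d * L ^ 2 * ℓ ^ 2 := by
      rw [mul_pow, mul_pow, Real.sq_sqrt (Nat.cast_nonneg _)]
    linarith
  · -- far points: sup bound and the cost is large
    have h1 : |h x - h y| ≤ 2 * H := by
      calc |h x - h y| ≤ |h x| + |h y| := abs_sub _ _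
        _ ≤ H + H := add_le_add (hH x) (hH y)
        _ = 2 * H := by ring
    have h2 : (h x - h y) ^ 2 ≤ 4 * H ^ 2 := by
      rw [← sq_abs (h x - h y)]
      nlinarith [abs_nonneg (h x - h y)]
    have h3 : Real.log (1 + 4 * ℓ ^ 2 / δ ^ 2) ≤ sinLogCost δ (x - y) :=
      log_le_sinLogCost_of_le_norm hℓ.le hge
    have h4 : 4 * H ^ 2 ≤ 4 * H ^ 2 / Real.log (1 + 4 * ℓ ^ 2 / δ ^ 2) * sinLogCost δ (x - y) := by
      rw [div_mul_eq_mul_div, le_div_iff₀ hΛ]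
      exact mul_le_mul_of_nonneg_left h3 (by positivity)
    linarith

/-! ## Pairing against a probability density -/

omit [DecidableEq d] in
/-- `(∫ h f)² = ∫∫ h(x)h(y) f(x)f(y)`. [folklore] -/
theorem sq_integral_mul_eq (h f : UnitAddTorus d → ℝ) :
    (∫ x, h x * f x) ^ 2 = ∫ x, ∫ y, h x * h y * (f x * f y) := by
  rw [sq, ← integral_mul_const]
  refine integral_congr_ae (Eventually.of_forall fun x => ?_)
  show h x * f x * ∫ y, h y * f y = ∫ y, h x * h y * (f x * f y)
  rw [← integral_const_mul]
  exact integral_congr_ae (Eventually.of_forall fun y => by ring)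

omit [DecidableEq d] in
/-- **The variance identity** against a continuous probability density `f`:
`∫∫ h(x)h(y) f(x)f(y) = ∫ h² f - ½ ∫∫ (h x - h y)² f(x)f(y)`. [folklore] -/
theorem integral_integral_mul_mul_eq {h f : UnitAddTorus d → ℝ} (hhc : Continuous h) (hfc : Continuous f)
    (hf1 : ∫ x, f x = 1) :
    ∫ x, ∫ y, h x * h y * (f x * f y) =
      (∫ x, h x ^ 2 * f x) - (1 / 2) * ∫ x, ∫ y, (h x - h y) ^ 2 * (f x * f y) := by
  -- the three pieces of the expanded square
  have hA : ∀ x, ∫ y, h x ^ 2 * (f x * f y) = h x ^ 2 * f x := fun x => by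
    have : (fun y => h x ^ 2 * (f x * f y)) = fun y => (h x ^ 2 * f x) * f y := by funext y; ring
    rw [this, integral_const_mul, hf1, mul_one]
  have hB : ∀ x, ∫ y, h y ^ 2 * (f x * f y) = f x * ∫ y, h y ^ 2 * f y := fun x => by
    rw [← integral_const_mul]
    exact integral_congr_ae (Eventually.of_forall fun y => by ring)
  have hC : ∀ x, ∫ y, h x * h y * (f x * f y) = (h x * f x) * ∫ y, h y * f y := fun x => by
    rw [← integral_const_mul]
    exact integral_congr_ae (Eventually.of_forall fun y => by ring)
  have i1 : ∀ x, Integrable (fun y => h x ^ 2 * (f x * f y)) volume := fun x =>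
    (continuous_const.mul (continuous_const.mul hfc)).integrable_unitAddTorus
  have i2 : ∀ x, Integrable (fun y => h y ^ 2 * (f x * f y)) volume := fun x =>
    ((hhc.pow 2).mul (continuous_const.mul hfc)).integrable_unitAddTorus
  have i3 : ∀ x, Integrable (fun y => h x * h y * (f x * f y)) volume := fun x =>
    ((continuous_const.mul hhc).mul (continuous_const.mul hfc)).integrable_unitAddTorus
  have hsq : ∀ x, ∫ y, (h x - h y) ^ 2 * (f x * f y) =
      h x ^ 2 * f x + f x * (∫ y, h y ^ 2 * f y) - 2 * ((h x * f x) * ∫ y, h y * f y) := by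
    intro x
    have e : (fun y => (h x - h y) ^ 2 * (f x * f y)) =
        fun y => h x ^ 2 * (f x * f y) + h y ^ 2 * (f x * f y) - 2 * (h x * h y * (f x * f y)) := by
      funext y; ring
    have i12 : Integrable (fun y => h x ^ 2 * (f x * f y) + h y ^ 2 * (f x * f y)) volume := (i1 x).add (i2 x)
    have i3' : Integrable (fun y => 2 * (h x * h y * (f x * f y))) volume := (i3 x).const_mul 2
    rw [e, integral_sub i12 i3', integral_add (i1 x) (i2 x), hA, hB, integral_const_mul, hC]
  simp_rw [hsq, hC]
  have j1 : Integrable (fun x => h x ^ 2 * f x) volume := ((hhc.pow 2).mul hfc).integrable_unitAddTorus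
  have j2 : Integrable (fun x => f x * ∫ y, h y ^ 2 * f y) volume := (hfc.mul continuous_const).integrable_unitAddTorus
  have j3 : Integrable (fun x => (h x * f x) * ∫ y, h y * f y) volume :=
    ((hhc.mul hfc).mul continuous_const).integrable_unitAddTorus
  have j12 : Integrable (fun x => h x ^ 2 * f x + f x * ∫ y, h y ^ 2 * f y) volume := j1.add j2
  have j3' : Integrable (fun x => 2 * ((h x * f x) * ∫ y, h y * f y)) volume := j3.const_mul 2
  rw [integral_sub j12 j3', integral_add j1 j2, integral_const_mul, integral_mul_const, integral_mul_const, hf1]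
  ring

/-! ## The initial value of the separation functional -/

omit [DecidableEq d] in
/-- **The separation functional of the mollifier pair**: `∫∫ Φ_δ(x-y) k_ε(x-w) k_ε(y-w) dx dy
≤ log(1 + 4π² d ε²/δ²)` (both factors live in the `ε`-ball around `w`, where
`Φ_δ(x - y) ≤ log(1 + π² d ‖x-y‖²/δ²) ≤ log(1 + π² d (2ε)²/δ²)`). [folklore] -/
theorem integral_integral_sinLogCost_kernel_le {ε : ℝ} (hε : 0 < ε) (hε4 : ε ≤ 1 / 4) (δ : ℝ)
    (w : UnitAddTorus d) :
    ∫ x, ∫ y, sinLogCost δ (x - y) * (kernel ε (x - w) * kernel ε (y - w)) ≤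
      Real.log (1 + 4 * π ^ 2 * Fintype.card d * ε ^ 2 / δ ^ 2) := by
  set q₀ : ℝ := Real.log (1 + 4 * π ^ 2 * Fintype.card d * ε ^ 2 / δ ^ 2) with hq₀
  have hkc : Continuous (kernel (d := d) ε) := continuous_kernel hε hε4
  have hk0 : ∀ z, 0 ≤ kernel (d := d) ε z := fun z => kernel_nonneg hε.le z
  -- pointwise: `Φ_δ(x-y) k(x-w) k(y-w) ≤ q₀ k(x-w) k(y-w)`
  have hpt : ∀ x y, sinLogCost δ (x - y) * (kernel ε (x - w) * kernel ε (y - w)) ≤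
      q₀ * (kernel ε (x - w) * kernel ε (y - w)) := by
    intro x y
    by_cases hx : kernel ε (x - w) = 0
    · simp [hx]
    by_cases hy : kernel ε (y - w) = 0
    · simp [hy]
    have hxb : ‖x - w‖ < ε := by
      have := support_kernel_subset hε (mem_support.2 hx); rwa [mem_ball, dist_zero_right] at this
    have hyb : ‖y - w‖ < ε := by
      have := support_kernel_subset hε (mem_support.2 hy); rwa [mem_ball, dist_zero_right] at this
    have hxy : ‖x - y‖ ≤ 2 * ε := by
      have : x - y = (x - w) - (y - w) := by abel
      rw [this]
      linarith [norm_sub_le (x - w) (y - w)]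
    refine mul_le_mul_of_nonneg_right ?_ (mul_nonneg (hk0 _) (hk0 _))
    refine (sinLogCost_le_log δ (x - y)).trans (Real.log_le_log (by positivity) ?_)
    have h1 : ‖x - y‖ ^ 2 ≤ (2 * ε) ^ 2 := pow_le_pow_left₀ (norm_nonneg _) hxy 2
    have h2 : π ^ 2 * Fintype.card d * ‖x - y‖ ^ 2 / δ ^ 2 ≤ π ^ 2 * Fintype.card d * (2 * ε) ^ 2 / δ ^ 2 :=
      div_le_div_of_nonneg_right (mul_le_mul_of_nonneg_left h1 (by positivity)) (sq_nonneg _)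
    have h3 : π ^ 2 * Fintype.card d * (2 * ε) ^ 2 / δ ^ 2 = 4 * π ^ 2 * Fintype.card d * ε ^ 2 / δ ^ 2 := by ring
    linarith
  -- integrate
  have hint : ∀ x, ∫ y, q₀ * (kernel ε (x - w) * kernel ε (y - w)) = q₀ * kernel ε (x - w) := fun x => by
    have : (fun y => q₀ * (kernel ε (x - w) * kernel ε (y - w))) = fun y => (q₀ * kernel ε (x - w)) * kernel ε (y - w) := by
      funext y; ring
    rw [this, integral_const_mul, integral_sub_right_eq_self (fun y => kernel (d := d) ε y) w,
      integral_kernel hε hε4, mul_one]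
  calc ∫ x, ∫ y, sinLogCost δ (x - y) * (kernel ε (x - w) * kernel ε (y - w))
      ≤ ∫ x, ∫ y, q₀ * (kernel ε (x - w) * kernel ε (y - w)) := by
        refine integral_mono ?_ ?_ fun x => integral_mono ?_ ?_ (hpt x)
        · have hc : Continuous (uncurry fun x y : UnitAddTorus d => sinLogCost δ (x - y) * (kernel ε (x - w) * kernel ε (y - w))) :=
            ((continuous_sinLogCost δ).comp (continuous_fst.sub continuous_snd)).mul
              ((hkc.comp (continuous_fst.sub continuous_const)).mul (hkc.comp (continuous_snd.sub continuous_const)))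
          exact (integrable_prod_of_continuous hc).integral_prod_left
        · simp_rw [hint]; exact (hkc.comp (continuous_id.sub continuous_const)).integrable_unitAddTorus.const_mul _
        · exact (((continuous_sinLogCost δ).comp (continuous_const.sub continuous_id)).mul
            (continuous_const.mul (hkc.comp (continuous_id.sub continuous_const)))).integrable_unitAddTorus
        · exact (continuous_const.mul (continuous_const.mul (hkc.comp (continuous_id.sub continuous_const)))).integrable_unitAddTorus
    _ = q₀ := by
        simp_rw [hint]
        rw [integral_const_mul, integral_sub_right_eq_self (fun y => kernel (d := d) ε y) w, integral_kernel hε hε4, mul_one]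

end Torus

end Literature.Analysis.FluidPDE
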